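import Literature.Topology.FourManifolds.SurfaceGroupEpimorphismsProofs
import Literature.GroupTheory.CombinatorialGroupTheory.QuadraticWordsForm
import Mathlib.GroupTheory.FreeGroup.CyclicallyReduced
import Mathlib.GroupTheory.Perm.Fin
import HarnessLib

/-!
# The surface relator `∏ [aᵢ, bᵢ]` is not a proper power

Topic `Literature/GroupTheory/CombinatorialGroupTheory`; theorems only.  In a free group an
element `r ≠ 1` whose reduced word has no repeated (signed) letter is not a proper power:
the reduced word of `tᵏ` is `C ++ Rᵏ ++ C⁻¹` with `R` the cyclic reduction of `t`
(Mathlib `FreeGroup.reduceCyclically.reduce_flatten_replicate`), and for `k ≥ 2`, `R ≠ []` this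
repeats a letter (`FreeGroup.pow_prim_of_nodup_toWord`).  The standard surface word
`a₁ b₁ a₁⁻¹ b₁⁻¹ ⋯ a_g b_g a_g⁻¹ b_g⁻¹` has no repeated letter (the tree's `nodup_surfaceWordStd`),
so the surface relator `r_g` of `Literature.Topology.FourManifolds.surfaceRelator` is not a proper
power for `g ≥ 1` (`surfaceRelator_pow_prim`), and neither is its inverse; `r_g ≠ 1`
(`surfaceRelator_ne_one`, seen in `S₃`).  These are the hypotheses under which the cyclic
subgroup `⟨r_g⟩` is malnormal in `F⟨a₁, …, b_g⟩` (`FreeGroupCentralizers.lean`), the free-factor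
input for the amalgam decomposition `S_{g+1} = F_{2g} *_ℤ F_2` of surface groups
(Lyndon–Schupp, Ch. I Prop. 2.17: in a free group every element is a power of a unique
non-power).

## References

* R. C. Lyndon, P. E. Schupp, *Combinatorial Group Theory*, Springer (1977); Classics in
  Mathematics (2001), Ch. I §2 (Prop. 2.17), §4. [LyndonSchupp2001]
-/

namespace Literature.GroupTheory.CombinatorialGroupTheory

open FreeGroup List Literature.Topology.FourManifolds

universe u

/-! ### Elements with a repetition-free reduced word are not proper powers -/

/-- **An element `r ≠ 1` of a free group whose reduced word has no repeated letter is not a proper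
power.** [cite: LyndonSchupp2001, Ch. I Prop. 2.17] -/
theorem FreeGroup.pow_prim_of_nodup_toWord {α : Type u} [DecidableEq α] {r : FreeGroup α}
    (hr : r ≠ 1) (hnd : r.toWord.Nodup) (t : FreeGroup α) (k : ℕ) (h : t ^ k = r) : k = 1 := by
  have hk0 : k ≠ 0 := by rintro rfl; exact hr (by rw [← h, pow_zero])
  by_contra hk1
  have hk2 : 2 ≤ k := by omega
  -- the reduced word of `t ^ k`
  have hw := congrArg FreeGroup.toWord h
  rw [FreeGroup.toWord_pow, reduceCyclically.reduce_flatten_replicate isReduced_toWord, if_neg hk0]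
    at hw
  set C := reduceCyclically.conjugator t.toWord
  set R := reduceCyclically t.toWord
  by_cases hR : R = []
  · -- then `t = C C⁻¹ = 1`
    have ht : t = 1 := by
      have e2 := congrArg FreeGroup.mk (reduceCyclically.conj_conjugator_reduceCyclically t.toWord)
      rw [FreeGroup.mk_toWord] at e2
      rw [← e2]
      change FreeGroup.mk (C ++ R ++ invRev C) = 1
      rw [hR, List.append_nil, ← FreeGroup.mul_mk, ← FreeGroup.inv_mk, mul_inv_cancel]
    exact hr (by rw [← h, ht, one_pow])
  · -- `R ^ k` repeats the first letter of `R`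
    obtain ⟨x, R', hxR⟩ := List.exists_cons_of_ne_nil hR
    have hsub : (List.replicate k R).flatten <+ r.toWord := by
      rw [← hw]
      exact (List.sublist_append_right _ _).trans (List.sublist_append_left _ _)
    have hnd' := hnd.sublist hsub
    obtain ⟨m, rfl⟩ := Nat.exists_eq_add_of_le hk2
    rw [show 2 + m = 1 + (1 + m) by ring, List.replicate_add, List.replicate_add, List.flatten_append,
      List.flatten_append, List.replicate_one, List.flatten_singleton, hxR] at hnd'
    have hx1 : x ∈ x :: R' := List.mem_cons_self
    have hx2 : x ∈ (x :: R') ++ (List.replicate m (x :: R')).flatten := List.mem_append_left _ hx1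
    exact (List.disjoint_of_nodup_append hnd') hx1 hx2

/-- If `r` is not a proper power then neither is `r⁻¹`. [cite: LyndonSchupp2001, Ch. I Prop. 2.17] -/
theorem pow_prim_inv {G : Type u} [Group G] {r : G} (hr : ∀ (t : G) (k : ℕ), t ^ k = r → k = 1)
    (t : G) (k : ℕ) (h : t ^ k = r⁻¹) : k = 1 :=
  hr t⁻¹ k (by rw [inv_pow, h, inv_inv])

/-! ### The surface relator -/

/-- **`r_g ≠ 1` for `g ≥ 1`**: under `a₁ ↦ (0 1)`, `b₁ ↦ (1 2)`, all other generators `↦ 1`, the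
relator `∏ [aᵢ, bᵢ]` maps to `[(0 1), (1 2)] ≠ 1` in `S₃`. [cite: LyndonSchupp2001, Ch. I §4] -/
theorem surfaceRelator_ne_one {g : ℕ} (hg : 1 ≤ g) : surfaceRelator g ≠ 1 := by
  classical
  obtain ⟨g', rfl⟩ := Nat.exists_eq_add_of_le' hg
  obtain ⟨f, hfa, hfb, hf⟩ : ∃ f : surfaceGen (g' + 1) → Equiv.Perm (Fin 3),
      f (0, false) = Equiv.swap 0 1 ∧ f (0, true) = Equiv.swap 1 2 ∧
        ∀ i : Fin (g' + 1), i ≠ 0 → ∀ b, f (i, b) = 1 :=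
    ⟨fun p => if p = (0, false) then Equiv.swap 0 1 else if p = (0, true) then Equiv.swap 1 2 else 1,
      by simp, by simp, fun i hi b => by simp [hi]⟩
  intro h
  have h' := congrArg (FreeGroup.lift f) h
  rw [surfaceRelator, map_list_prod, List.map_map, MonoidHom.map_one, List.finRange_succ,
    List.map_cons, List.prod_cons, List.map_map] at h'
  have hrest : ((List.finRange g').map
      ((⇑(FreeGroup.lift f) ∘ fun i => genA i * genB i * (genA i)⁻¹ * (genB i)⁻¹) ∘ Fin.succ)).prod
        = 1 := by
    refine List.prod_eq_one fun x hx => ?_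
    rw [List.mem_map] at hx
    obtain ⟨i, -, rfl⟩ := hx
    simp [genA, genB, hf _ (Fin.succ_ne_zero i)]
  rw [hrest, mul_one] at h'
  simp only [Function.comp_apply, genA, genB, _root_.map_mul, _root_.map_inv, FreeGroup.lift_apply_of, hfa,
    hfb] at h'
  exact absurd h' (by decide)

/-- The reduced word of the surface relator has no repeated letter (it is a sublist of the
standard surface word). [cite: LyndonSchupp2001, Ch. I §4] -/
theorem nodup_toWord_surfaceRelator (g : ℕ) : (surfaceRelator g).toWord.Nodup := by
  rw [← SurfaceGroup.mk_surfaceWordStd, FreeGroup.toWord_mk]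
  exact (nodup_surfaceWordStd g).sublist FreeGroup.reduce.red.sublist

/-- **The surface relator `r_g = ∏_{i<g} [aᵢ, bᵢ]` (`g ≥ 1`) is not a proper power** in the free
group `F⟨a₁, b₁, …, a_g, b_g⟩`. [cite: LyndonSchupp2001, Ch. I Prop. 2.17] -/
theorem surfaceRelator_pow_prim {g : ℕ} (hg : 1 ≤ g) (t : FreeGroup (surfaceGen g)) (k : ℕ)
    (h : t ^ k = surfaceRelator g) : k = 1 :=
  FreeGroup.pow_prim_of_nodup_toWord (surfaceRelator_ne_one hg) (nodup_toWord_surfaceRelator g) t k h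

/-- The inverse surface relator `r_g⁻¹` (`g ≥ 1`) is not a proper power either.
[cite: LyndonSchupp2001, Ch. I Prop. 2.17] -/
theorem surfaceRelator_inv_pow_prim {g : ℕ} (hg : 1 ≤ g) (t : FreeGroup (surfaceGen g)) (k : ℕ)
    (h : t ^ k = (surfaceRelator g)⁻¹) : k = 1 :=
  pow_prim_inv (surfaceRelator_pow_prim hg) t k h

end Literature.GroupTheory.CombinatorialGroupTheory
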